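import Summits.AtomisticToContinuum.Crystallization.Theorems.ChargedEnergyGap.Negative.FarCopies
import Literature.MathematicalPhysics.StatisticalMechanics.PeriodicConfigurationSums
import Literature.MathematicalPhysics.StatisticalMechanics.StablePotentialsProofs

/-!
# Blocks of a periodic configuration I: the energy identity

Finite blocks `F + {Σ kᵢ bᵢ : 0 ≤ kᵢ < K}` of a periodic configuration `Q = F + G` of `ℝ³` (`b` a
`ℤ`-basis of `G`): the block is an injective finite configuration of `#F·K³` points, and its
Lennard-Jones energy satisfies the exact identity
`2·E(block) = K³ · 2#F · e(Q) − Σ_{p ∈ block} T(p)`, `T(p) = Σ_{q ∈ Q ∖ block} V(|p − q|)`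
(lattice sums are absolutely summable in `d = 3`), whence
`e(Q) ≥ −2³²/12 + (Σ T)/(2#F K³)` by finite stability.  Parts II–III show that the tails are small
on average and conclude that periodic Lennard-Jones energies per particle are bounded below
(item 0714) and that blocks are trial states (item 11865).  Written for the negative-side
analysis of crux `ChargedEnergyGap` (stmt-14231): it makes its `κ = 0` half and its tolerance
analysis unconditional.  All `[folklore]`.
-/

noncomputable section

namespace Summit.AtomisticToContinuum.Crystallization.Theorems.ChargedEnergyGapNegative

open Literature.MathematicalPhysics.StatisticalMechanics
open scoped BigOperators

namespace Blocks

variable (Q : PeriodicConfiguration 3)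

/-- A `ℤ`-basis of the lattice of periods indexed by `Fin 3`. [folklore] -/
def zBasis : Module.Basis (Fin 3) ℤ Q.lattice :=
  Module.finBasisOfFinrankEq ℤ Q.lattice Q.finrank_lattice

/-- The lattice vector with integer coordinates `c` in the basis. [folklore] -/
def latVecL (c : Fin 3 → ℤ) : Q.lattice := (zBasis Q).equivFun.symm c

/-- The same as a vector of `ℝ³`. [folklore] -/
def latVec (c : Fin 3 → ℤ) : E3 := (latVecL Q c : E3)

/-- `latVec c` is a period. [folklore] -/
theorem latVec_mem (c : Fin 3 → ℤ) : latVec Q c ∈ Q.lattice := (latVecL Q c).2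

/-- `latVec` is additive. [folklore] -/
theorem latVec_add (c c' : Fin 3 → ℤ) : latVec Q (c + c') = latVec Q c + latVec Q c' := by
  simp [latVec, latVecL, map_add]

/-- `latVec` is compatible with negation. [folklore] -/
theorem latVec_neg (c : Fin 3 → ℤ) : latVec Q (-c) = -latVec Q c := by
  simp [latVec, latVecL, map_neg]

/-- `latVec` is compatible with subtraction. [folklore] -/
theorem latVec_sub (c c' : Fin 3 → ℤ) : latVec Q (c - c') = latVec Q c - latVec Q c' := by
  simp [latVec, latVecL, map_sub]

/-- `latVec 0 = 0`. [folklore] -/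
theorem latVec_zero : latVec Q 0 = 0 := by
  simp [latVec, latVecL]

/-- `latVec` is injective. [folklore] -/
theorem latVec_injective : Function.Injective (latVec Q) := by
  intro c c' h
  have : latVecL Q c = latVecL Q c' := Subtype.ext h
  exact (zBasis Q).equivFun.symm.injective this

/-- Every period has integer coordinates: `g = latVec c` for a unique `c`. [folklore] -/
theorem exists_latVec_eq {g : E3} (hg : g ∈ Q.lattice) : ∃ c, latVec Q c = g :=
  ⟨(zBasis Q).equivFun ⟨g, hg⟩, by simp [latVec, latVecL]⟩

variable (K : ℕ)

/-- Index type of the block: a motif point and lattice coordinates in `[0, K)³`. [folklore] -/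
abbrev BIdx : Type := Q.motif × (Fin 3 → Fin K)

/-- The integer coordinates of a block index. [folklore] -/
def coords (k : Fin 3 → Fin K) : Fin 3 → ℤ := fun i => ((k i : ℕ) : ℤ)

/-- `coords` is injective. [folklore] -/
theorem coords_injective : Function.Injective (coords K) := by
  intro k k' h
  funext i
  have := congrFun h i
  simp only [coords, Nat.cast_inj] at this
  exact Fin.ext this

/-- The block point `x + Σ kᵢ bᵢ`. [folklore] -/
def bpt (u : BIdx Q K) : E3 := (u.1 : E3) + latVec Q (coords K u.2)

/-- Block points are points of the configuration. [folklore] -/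
theorem bpt_mem (u : BIdx Q K) : bpt Q K u ∈ Q.points :=
  Q.add_mem_points (Q.mem_points_of_mem_motif u.1.2) (latVec_mem Q _)

/-- Block points are pairwise distinct. [folklore] -/
theorem bpt_injective : Function.Injective (bpt Q K) := by
  rintro ⟨x, k⟩ ⟨x', k'⟩ h
  simp only [bpt] at h
  have hsub : (x : E3) - x' = latVec Q (coords K k') - latVec Q (coords K k) := by
    rw [sub_eq_sub_iff_add_eq_add, h, add_comm]
  have hmem : (x : E3) - x' ∈ Q.lattice := by
    rw [hsub, ← latVec_sub]; exact latVec_mem Q _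
  have hx : (x : E3) = x' := Q.eq_of_sub_mem x x.2 x' x'.2 hmem
  have hk : latVec Q (coords K k) = latVec Q (coords K k') := by
    rw [hx] at h; exact add_left_cancel h
  exact Prod.ext (Subtype.ext hx) (coords_injective K (latVec_injective Q hk))

/-- The block has `#F · K³` points. [folklore] -/
theorem card_BIdx : Fintype.card (BIdx Q K) = Q.motif.card * K ^ 3 := by
  rw [Fintype.card_prod, Fintype.card_coe, Fintype.card_fun, Fintype.card_fin, Fintype.card_fin]

/-- The block as a configuration indexed by `Fin (#F · K³)`. [folklore] -/
def blockConfig : Fin (Fintype.card (BIdx Q K)) → E3 :=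
  bpt Q K ∘ (Fintype.equivFin (BIdx Q K)).symm

/-- Unfolding `blockConfig`. [folklore] -/
theorem blockConfig_apply (a : Fin (Fintype.card (BIdx Q K))) :
    blockConfig Q K a = bpt Q K ((Fintype.equivFin (BIdx Q K)).symm a) := rfl

/-- The block configuration is injective. [folklore] -/
theorem blockConfig_injective : Function.Injective (blockConfig Q K) :=
  (bpt_injective Q K).comp (Fintype.equivFin (BIdx Q K)).symm.injective

/-! ### Site sums and their translation invariance -/

/-- The (full) lattice sum of `V` at a point `p`: `Σ_{q ∈ Q, q ≠ p} V(|p − q|)`. [folklore] -/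
def siteSum (V : ℝ → ℝ) (p : E3) : ℝ :=
  ∑' q : {q : E3 // q ∈ Q.points ∧ q ≠ p}, V (dist p q.1)

/-- `e(Q) = (2#F)⁻¹ Σ_{x ∈ F} siteSum x` (the definition). [folklore] -/
theorem energyPerParticle_eq (V : ℝ → ℝ) :
    Q.energyPerParticle V = (2 * (Q.motif.card : ℝ))⁻¹ * ∑ x ∈ Q.motif, siteSum Q V x := rfl

/-- Translating by a period permutes the other points. [folklore] -/
def shiftEquiv {g : E3} (hg : g ∈ Q.lattice) (x : E3) :
    {q : E3 // q ∈ Q.points ∧ q ≠ x} ≃ {q : E3 // q ∈ Q.points ∧ q ≠ x + g} where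
  toFun q := ⟨q.1 + g, Q.add_mem_points q.2.1 hg, fun h => q.2.2 (add_right_cancel h)⟩
  invFun q := ⟨q.1 - g, by
      have := Q.add_mem_points q.2.1 (Q.lattice.neg_mem hg)
      simpa [sub_eq_add_neg] using this,
    fun h => q.2.2 (eq_add_of_sub_eq h)⟩
  left_inv q := Subtype.ext (by simp)
  right_inv q := Subtype.ext (by simp)

/-- **Translation invariance of site sums.** [folklore] -/
theorem siteSum_add (V : ℝ → ℝ) {g : E3} (hg : g ∈ Q.lattice) (x : E3) :
    siteSum Q V (x + g) = siteSum Q V x := by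
  unfold siteSum
  rw [← Equiv.tsum_eq (shiftEquiv Q hg x)]
  congr 1
  funext q
  simp [shiftEquiv, dist_add_right]

/-- In particular at block points: `siteSum (x + Σ kᵢbᵢ) = siteSum x`. [folklore] -/
theorem siteSum_bpt (V : ℝ → ℝ) (u : BIdx Q K) : siteSum Q V (bpt Q K u) = siteSum Q V u.1 :=
  siteSum_add Q V (latVec_mem Q _) _

/-! ### Splitting a site sum at a block point into block part and tail -/

/-- The other block points, as a finite set of "other points of `Q`" at the block point `u`.
[folklore] -/
def blockOthers (u : BIdx Q K) : Finset {q : E3 // q ∈ Q.points ∧ q ≠ bpt Q K u} :=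
  (Finset.univ.erase u).attach.image fun v =>
    ⟨bpt Q K v.1, bpt_mem Q K v.1, (bpt_injective Q K).ne (Finset.ne_of_mem_erase v.2)⟩

/-- The TAIL of the site sum at the block point `u`: the terms from points outside the block.
[folklore] -/
def tail (V : ℝ → ℝ) (u : BIdx Q K) : ℝ :=
  ∑' q : ((blockOthers Q K u : Set {q : E3 // q ∈ Q.points ∧ q ≠ bpt Q K u})ᶜ : Set _),
    V (dist (bpt Q K u) q.1.1)

/-- The block part of the site sum is the finite sum over the other block points. [folklore] -/
theorem sum_blockOthers (V : ℝ → ℝ) (u : BIdx Q K) :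
    ∑ q ∈ blockOthers Q K u, V (dist (bpt Q K u) q.1) =
      ∑ v ∈ Finset.univ.erase u, V (dist (bpt Q K u) (bpt Q K v)) := by
  unfold blockOthers
  rw [Finset.sum_image]
  · exact Finset.sum_attach (Finset.univ.erase u) fun v => V (dist (bpt Q K u) (bpt Q K v))
  · intro v _ w _ h
    exact Subtype.ext ((bpt_injective Q K) (congrArg Subtype.val h))

/-- **Splitting**: for Lennard-Jones (summable lattice sums in `d = 3`),
`siteSum (block point u) = Σ_{v ≠ u} V(|u − v|) + tail u`. [folklore] -/
theorem siteSum_eq_sum_add_tail (u : BIdx Q K) :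
    siteSum Q lennardJones (bpt Q K u) =
      ∑ v ∈ Finset.univ.erase u, lennardJones (dist (bpt Q K u) (bpt Q K v)) +
        tail Q K lennardJones u := by
  unfold siteSum tail
  rw [← sum_blockOthers, (Q.summable_lennardJones_dist_three (bpt Q K u)).sum_add_tsum_compl]

/-! ### The energy identity of a block -/

/-- Twice the energy of the block is the double sum over block indices (diagonal terms vanish,
`V_LJ(0) = 0`). [folklore] -/
theorem two_mul_energy_blockConfig :
    2 * interactionEnergy lennardJones (blockConfig Q K) =
      ∑ u : BIdx Q K, ∑ v : BIdx Q K, lennardJones (dist (bpt Q K u) (bpt Q K v)) := by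
  rw [two_mul_interactionEnergy_eq_sum_sum lennardJones lennardJones_zero]
  simp only [blockConfig_apply]
  exact ((Fintype.equivFin (BIdx Q K)).symm.sum_comp (fun p => ∑ b,
    lennardJones (dist (bpt Q K p) (bpt Q K ((Fintype.equivFin (BIdx Q K)).symm b))))).trans
    (Finset.sum_congr rfl fun p _ => (Fintype.equivFin (BIdx Q K)).symm.sum_comp
      (fun q => lennardJones (dist (bpt Q K p) (bpt Q K q))))

/-- The row sums are site sums minus tails. [folklore] -/
theorem sum_row_eq (u : BIdx Q K) :
    ∑ v : BIdx Q K, lennardJones (dist (bpt Q K u) (bpt Q K v)) =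
      siteSum Q lennardJones u.1 - tail Q K lennardJones u := by
  rw [← siteSum_bpt Q K, siteSum_eq_sum_add_tail, ← Finset.add_sum_erase _ _ (Finset.mem_univ u),
    dist_self, lennardJones_zero]
  ring

/-- `Σ_{x ∈ F} siteSum x = 2#F · e(Q)`. [folklore] -/
theorem sum_siteSum_eq (V : ℝ → ℝ) :
    ∑ x ∈ Q.motif, siteSum Q V x = 2 * Q.motif.card * Q.energyPerParticle V := by
  have hF : (0 : ℝ) < Q.motif.card := by exact_mod_cast Q.motif_nonempty.card_pos
  rw [energyPerParticle_eq]
  field_simp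

/-- **The energy identity of a block**:
`2·E(block_K) = K³ · 2#F · e(Q) − Σ_u tail(u)`. [folklore] -/
theorem two_mul_energy_block_eq :
    2 * interactionEnergy lennardJones (blockConfig Q K) =
      (K : ℝ) ^ 3 * (2 * Q.motif.card * Q.energyPerParticle lennardJones) -
        ∑ u : BIdx Q K, tail Q K lennardJones u := by
  rw [two_mul_energy_blockConfig, Finset.sum_congr rfl fun u _ => sum_row_eq Q K u,
    Finset.sum_sub_distrib, ← sum_siteSum_eq, Fintype.sum_prod_type]
  simp only [Finset.sum_const, Finset.card_univ, Fintype.card_fun, Fintype.card_fin, nsmul_eq_mul]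
  rw [← Finset.mul_sum, Finset.sum_coe_sort Q.motif (siteSum Q lennardJones)]
  push_cast
  ring

/-- **Lower bound on `e(Q)` from finite stability**: for `K ≥ 1`,
`e(Q) ≥ −2³²/12 + (Σ_u tail u)/(2 #F K³)`. [folklore] -/
theorem energyPerParticle_ge_tail {K : ℕ} (hK : 0 < K) :
    -(65536 ^ 2 / 12 : ℝ) +
        (∑ u : BIdx Q K, tail Q K lennardJones u) / (2 * Q.motif.card * (K : ℝ) ^ 3) ≤
      Q.energyPerParticle lennardJones := by
  have hF : (0 : ℝ) < Q.motif.card := by exact_mod_cast Q.motif_nonempty.card_pos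
  have hK' : (0 : ℝ) < (K : ℝ) ^ 3 := by positivity
  have hstab := le_interactionEnergy_lennardJones (by norm_num : 3 ≤ 5) _ (blockConfig Q K)
    (blockConfig_injective Q K)
  have hn : ((Fintype.card (BIdx Q K) : ℕ) : ℝ) = Q.motif.card * (K : ℝ) ^ 3 := by
    exact_mod_cast card_BIdx Q K
  rw [hn] at hstab
  have hid := two_mul_energy_block_eq Q K
  have hpos : (0 : ℝ) < 2 * Q.motif.card * (K : ℝ) ^ 3 := by positivity
  have h1 : ∑ u : BIdx Q K, tail Q K lennardJones u ≤
      (Q.energyPerParticle lennardJones + 65536 ^ 2 / 12) * (2 * Q.motif.card * (K : ℝ) ^ 3) := by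
    nlinarith
  have h2 := (div_le_iff₀ hpos).2 h1
  linarith


end Blocks

end Summit.AtomisticToContinuum.Crystallization.Theorems.ChargedEnergyGapNegative

end
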